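import Literature.NumberTheory.Transcendental.AyoubPeriodSeries
import Literature.NumberTheory.Transcendental.AyoubPeriodSeriesPiAlgebraic
import Literature.NumberTheory.Transcendental.AyoubPeriodSeriesKernel
import Literature.NumberTheory.Transcendental.CurvePeriods
import Literature.NumberTheory.Transcendental.AyoubPeriodSeriesDescent
import Literature.NumberTheory.Transcendental.SemialgebraicMaps
import Summits.KontsevichZagierPeriods.KontsevichZagierPeriods.Theses.HermiteRigidity

/-!
# Sketch — crux idea `curve-sector-chain-rule` for `AyoubEffectiveCubeKernel`
(stmt-KontsevichZagierPeriods-18116; crux-ideate round 1, ideator 2)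

Typed statements (and two proved bricks) for the idea card: the ONE-VARIABLE (= curve-type,
Huber–Wüstholz `𝒫¹`) sector of Ayoub's Conjecture 1.1 at `k = ℚ`, with certificates of ARITY TWO.
Nothing here is registered as a stub; this file only certifies that the card's signatures elaborate.
-/

noncomputable section

-- `Summit.KontsevichZagierPeriods.KontsevichZagierPeriods.…` is the tree's mandated layout (single-conjunct summit).
set_option linter.dupNamespace false

namespace Summit.KontsevichZagierPeriods.KontsevichZagierPeriods.Cruxes.AyoubEffectiveCubeKernel.CurveSector

open Literature.NumberTheory.Transcendental
open Literature.NumberTheory.Transcendental.AyoubRel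
open Summit.KontsevichZagierPeriods.KontsevichZagierPeriods.Theses.HermiteRigidity (AyoubEffectiveCubeKernel)

/-- The embedding `ℚ → ℂ` of the crux. -/
abbrev σℚ : ℚ →+* ℂ := Rat.castHom ℂ

/-- The type-(a) span of the crux (its literal conclusion set). [cite: Ayoub2015, Conj. 1.1] -/
def typeASpan : Set CSeries :=
  kSpan σℚ {x : CSeries | ∃ G ∈ Oan σℚ, ∃ i : ℕ, x = relAC i G}

/-- The ARITY-`m` type-(a) span: certificates `G` in the variables `z₀,…,z_{m-1}` only and
operators `∂ᵢ − (·)|_{zᵢ=1} + (·)|_{zᵢ=0}` with `i < m` (Ayoub's variable count, Rem. 1.2).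
[cite: Ayoub2015, Rem. 1.2] -/
def typeASpanLT (m : ℕ) : Set CSeries :=
  kSpan σℚ {x : CSeries | ∃ G ∈ Oan σℚ, DependsOnlyOnLT G m ∧ ∃ i : ℕ, i < m ∧ x = relAC i G}

/-- `kSpan` is monotone in the generating set. [folklore] -/
theorem kSpan_mono {M : Type*} [AddCommGroup M] [Module ℂ M] {S T : Set M} (h : S ⊆ T) :
    kSpan σℚ S ⊆ kSpan σℚ T := by
  rintro x ⟨n, c, s, hs, rfl⟩
  exact ⟨n, c, s, fun j => h (hs j), rfl⟩

/-- Arity-bounded certificates are certificates. [folklore] -/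
theorem typeASpanLT_subset (m : ℕ) : typeASpanLT m ⊆ typeASpan :=
  kSpan_mono (by rintro x ⟨G, hG, -, i, -, rfl⟩; exact ⟨G, hG, i, rfl⟩)

/-- THE SECTOR (curve type): every ONE-VARIABLE element of the kernel of `∫_{[0,1]^∞}` on
`𝒪_{ℚ-alg}(𝔻̄^∞)` lies in the `ℚ`-span of the type-(a) elements. Its set of values
`{∫₀¹ F}` is exactly the space `𝒫¹` of periods of curve type (Huber–Wüstholz 2022, Def. 12.6).
[cite: Ayoub2015, Conj. 1.1] [cite: HuberWustholz2022, Thm. 13.3 (2)] -/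
def CurveSectorTypeA : Prop :=
  ∀ F ∈ Oan σℚ, DependsOnlyOnLT F 1 → intC F = 0 → F ∈ typeASpan

/-- THE SHARP FORM ("two variables suffice in one variable"; contrast Ayoub's heuristic "plus de
`n + 1` variables", Rem. 1.2, and the tree barrier `kernelElt_not_stokes_one_variable` showing ONE
variable does not suffice). [cite: Ayoub2015, Rem. 1.2 and Rem. 1.5] -/
def CurveSectorArityTwo : Prop :=
  ∀ F ∈ Oan σℚ, DependsOnlyOnLT F 1 → intC F = 0 → F ∈ typeASpanLT 2

/-- The sharp form implies the sector. [folklore] -/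
theorem curveSectorTypeA_of_arityTwo (h : CurveSectorArityTwo) : CurveSectorTypeA :=
  fun F hF h1 h0 => typeASpanLT_subset 2 (h F hF h1 h0)

/-- The sector is a FRAGMENT of the crux (so a disproof of the sector refutes the crux).
[cite: Ayoub2015, Conj. 1.1] -/
theorem curveSectorTypeA_of_crux (h : AyoubEffectiveCubeKernel) : CurveSectorTypeA :=
  fun F hF _ h0 => h F hF h0

/-! ### Brick 0 — square Stokes (the only place a second variable is spent) -/

/-- **Square Stokes.** If `P dz₀ + Q dz₁` is CLOSED (`∂₀Q = ∂₁P` coefficientwise) then the signed sum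
of its four edge restrictions is the type-(a) element `relAC 0 Q − relAC 1 P`; in particular it lies
in the arity-2 span. This is how a `C¹`/Nash 2-simplex on a curve (relation (R5) of
`CurvePeriods.IsElementaryRelation`) and the triangle relation among `∫_{[a,b]} dx/x` are certified.
[cite: Ayoub2015, Rem. 1.5] [cite: HuberWustholz2022, §3.3.1] -/
theorem squareStokes_mem {P Q : CSeries} (hP : P ∈ Oan σℚ) (hQ : Q ∈ Oan σℚ)
    (hP2 : DependsOnlyOnLT P 2) (hQ2 : DependsOnlyOnLT Q 2) (hclosed : pdz 0 Q = pdz 1 P) :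
    restrC 1 1 P - restrC 1 0 P - restrC 0 1 Q + restrC 0 0 Q ∈ typeASpanLT 2 := by
  have key : restrC 1 1 P - restrC 1 0 P - restrC 0 1 Q + restrC 0 0 Q =
      relAC 0 Q - relAC 1 P := by
    simp only [relAC, hclosed]; abel
  rw [key]
  refine ⟨2, ![1, -1], ![relAC 0 Q, relAC 1 P], fun j => ?_, ?_⟩
  · fin_cases j
    · exact ⟨Q, hQ, hQ2, 0, by norm_num, rfl⟩
    · exact ⟨P, hP, hP2, 1, by norm_num, rfl⟩
  · simp [Fin.sum_univ_two, sub_eq_add_neg]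

/-! ### The edge series of `∫_{[a,b]} dx/x` and the first lemma -/

/-- The cube integrand of `∫_{[a,b]} dx/x` after the affine parametrisation `x = a + (b − a)t`:
`(b − a)/(a + (b − a)t) = w/(1 + w t)` with `w = (b − a)/a`; it depends on `b/a` ONLY (scaling of
`dx/x` is free in cube coordinates). As a power series in `z₀`: coefficient of `z₀ⁿ` is `w(−w)ⁿ`.
Its integral is the principal `Log (1 + w)` for `‖w‖ < 1`. [folklore] -/
def edge (w : ℂ) : CSeries :=
  fun a => if a = Finsupp.single 0 (a 0) then w * (-w) ^ (a 0) else 0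

/-- VALUE of an edge (statement): `∫₀¹ w dt/(1 + wt) = Log(1 + w)` (`‖w‖ < 1`), i.e.
`intC (edge w) = Σₙ w(−w)ⁿ/(n+1)`; Mathlib: `Complex.hasSum_taylorSeries_log`. [folklore] -/
def EdgeValue : Prop :=
  ∀ w : ℂ, ‖w‖ < 1 → intC (edge w) = Complex.log (1 + w)

/-- **FIRST LEMMA (triangle certificate).** For algebraic `u, v` of small modulus the three edges of
the affine triangle `(1, 1+u, (1+u)(1+v))` in `ℂˣ` — integrands `edge u`, `edge v`,
`edge ((1+u)(1+v) − 1)` — satisfy `edge u + edge v − edge((1+u)(1+v) − 1) ∈` arity-2 span: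
pull `dx/x` back along the affine square-to-triangle map `(t₀,t₁) ↦ 1 + t₀u + t₀t₁(1+u)v`,
get a CLOSED pair `(P, Q)` of RATIONAL functions over `ℚ̄`, regular on the closed bidisc
(denominator `≠ 0` there by smallness), and apply `squareStokes_mem`; the fourth edge is degenerate
(`Q|_{t₀=0} = 0`). This is the multiplicativity `Log(1+u) + Log(1+v) = Log((1+u)(1+v))` as a
type-(a) identity. [cite: Ayoub2015, Rem. 1.5] -/
def TriangleCertificate : Prop :=
  ∀ u v : ℂ, IsAlgebraic ℚ u → IsAlgebraic ℚ v → ‖u‖ < 1 / 4 → ‖v‖ < 1 / 4 →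
    edge u + edge v - edge ((1 + u) * (1 + v) - 1) ∈ typeASpanLT 2

/-- **RESIDUE-POLYGON SUB-SECTOR (unconditional target, from the PROVED `baker_holds` /
`CurvePeriods.huberWustholzCurvePeriods_of_affineLine_or_mulGroup`).** An INTEGER combination of
edges with vanishing integral — `Σ mⱼ Log(1 + wⱼ) = 0`, a closed polygon
`1 → (1+w₁)^{m₁} → ⋯ → 1` in `ℂˣ` of winding number `0` — lies in the arity-2 span (fill the
polygon by small affine triangles avoiding `0`; each is `TriangleCertificate`, internal edges cancel
by the orientation-reversal certificate `f(t) ≡ f(1 − t)`). With partial fractions and Baker's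
theorem this gives the whole rational one-variable sector `ℚ̄(z₀) ∩ 𝒪_{ℚ-alg}(𝔻̄¹)`.
[cite: Baker1975, Thm. 2.1] [cite: Ayoub2015, Rem. 1.5] -/
def ResiduePolygonSector : Prop :=
  ∀ (k : ℕ) (w : Fin k → ℂ) (m : Fin k → ℤ), (∀ j, IsAlgebraic ℚ (w j)) → (∀ j, ‖w j‖ < 1) →
    intC (∑ j, (m j : ℂ) • edge (w j)) = 0 → (∑ j, (m j : ℂ) • edge (w j)) ∈ typeASpanLT 2

/-! ### The dictionary to Huber–Wüstholz symbols (direct "Fait 1.4" at level one) -/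

/-- A one-variable element `F` REALISES the period symbol `s = (Z, ω, γ)` of curve type
(`CurvePeriods.PeriodSymbol`) if its power series sums, on `[0,1]`, to the symbol's integrand
`t ↦ Σᵢ ωᵢ(γ(t)) γᵢ′(t)` (so `∫₀¹ F = ∫_γ ω = s.period`). Only symbols with (piecewise) NASH paths
are realised; every class of `H₁(Z^an, D; ℚ)` has such representatives, and the given `F` realises
its own symbol (the étale chart of Ayoub's Lemme 1.3 restricted to `n = 1`).
[cite: Ayoub2015, Lemme 1.3] [cite: HuberWustholz2022, §3.3.1] -/
def Realises (s : CurvePeriods.PeriodSymbol) (F : CSeries) : Prop :=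
  F ∈ Oan σℚ ∧ DependsOnlyOnLT F 1 ∧
    ∀ t ∈ Set.Icc (0 : ℝ) 1,
      HasSum (fun n : ℕ => MvPowerSeries.coeff (Finsupp.single 0 n) F * (t : ℂ) ^ n)
        (∑ i, MvPolynomial.eval (s.γ.toFun t) (s.ω i) * deriv (fun u => s.γ.toFun u i) t)

/-- **REALISATION LEMMA (direct Fait 1.4 at level one, the load-bearing transcendence-FREE step).**
For every elementary relation `c` among curve-type symbols (R1 linearity, R2 vanishing forms,
R3 exact forms, R4 push-forward along morphisms of pairs, R5 boundaries of triangles) and every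
choice of realisations `θ s` of the symbols in its support, the realised combination
`Σ_s c_s · θ s` lies in the ARITY-2 span. Mechanism: R1/R2 are identities of series; R3 is ONE
`relAC` in one variable (`(P∘γ)′ = relAC₀(P∘γ) + const`); R4 is FREE — the two integrands
`⟨f^*ω′(γ), γ′⟩` and `⟨ω′(f∘γ), (f∘γ)′⟩` are the same function (chain rule); R5 is
`squareStokes_mem` after a Nash parametrisation of the triangle. (Different realisations of one
symbol differ by reparametrisation — Ayoub's two-variable certificate of Rem. 1.5 — and by Nash
homotopies — `squareStokes_mem` again.) [cite: Ayoub2015, Rem. 1.5, Fait 1.4] [cite: HuberWustholz2022, Thm. 13.3 (2)] -/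
def RealisationLemma : Prop :=
  ∀ (c : CurvePeriods.PeriodSymbol →₀ ℂ) (θ : CurvePeriods.PeriodSymbol → CSeries),
    (∀ s ∈ c.support, Realises s (θ s)) → CurvePeriods.IsElementaryRelation c →
      c.sum (fun s a => a • θ s) ∈ typeASpanLT 2


/-! ### The `ℚ̄`-form and the route-level PAYOFF (dimension `≤ 1` of the summit) -/

/-- The sector in the `ℚ̄`-form consumed by the landed line-reduction machinery
(`StokesGenerationLine.sum_cubeNash_mem_relations_of_typeA` takes `hT` over
`algebraMap (algebraicClosure ℚ ℂ) ℂ`). [cite: Fresan2024, Conj. 3.5] -/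
def CurveSectorTypeAQbar : Prop :=
  ∀ F ∈ Oan (algebraMap (algebraicClosure ℚ ℂ) ℂ), DependsOnlyOnLT F 1 → intC F = 0 →
    F ∈ kSpan (algebraMap (algebraicClosure ℚ ℂ) ℂ)
      {x : CSeries | ∃ G ∈ Oan (algebraMap (algebraicClosure ℚ ℂ) ℂ), ∃ i : ℕ, x = relAC i G}

/-- `ℚ`-form ⇒ `ℚ̄`-form (`𝒪_{ℚ̄-alg} = 𝒪_{ℚ-alg}`, a `ℚ`-combination is a `ℚ̄`-combination).
[cite: Fresan2024, Conj. 3.5] -/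
theorem curveSectorTypeAQbar_of_rat (h : CurveSectorTypeA) : CurveSectorTypeAQbar := by
  intro F hF h1 h0
  have e : (algebraMap ℚ ℂ : ℚ →+* ℂ) = σℚ := rfl
  rw [Oan_algebraicClosure_eq_Oan_rat] at hF ⊢
  rw [e] at hF ⊢
  exact kSpan_rat_subset _ _ (e ▸ h F hF h1 h0)

/-- **PAYOFF TARGET — Conjecture 1 in dimension `≤ 1`, for ALL integral representations** (any
`ℚ`-semialgebraic domains in `ℝ⁰`, `ℝ¹`, any admissible integrands; no rationality): the statement
route LowDimension reaches only through its open XL crux `PlanarAreas` (stmt-4990) via the PROVED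
`LowdimHuberWustholzTransfer`. Chain (card § Why it bites here): dim `≤ 1` reps ⇒ cube–Nash
generators OF DIMENSION `≤ 1` (LiftingCriteria's landed `of_mem_of_volume_two` / `of_mem_of_Ioo` /
`of_mem_of_dim_one`, re-instantiated) ⇒ merge in dimension `1` ⇒ `stub_germToOan` gives a
ONE-variable `F` with `intC F = 0` ⇒ `CurveSectorTypeAQbar` ⇒ `stub_spanToReps` ⇒
`stub_cubeCalibration`. [cite: KontsevichZagier2001, §1.2 Conjecture 1] -/
def DimLeOneConjecture : Prop :=
  ∀ ⦃n m : ℕ⦄, n ≤ 1 → m ≤ 1 →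
    ∀ (r : KZ.IntegralRep n) (r' : KZ.IntegralRep m), r.value = r'.value → KZ.Equivalent r r'

/-- Missing link (size M, pure re-instantiation of landed LiftingCriteria files): representations of
dimension `≤ 1` lie in every subgroup containing the relations and the cube–Nash generators OF
DIMENSION `≤ 1` (the landed `CubeNashNormalFormDimLeOne.of_mem_of_dim_le_one` asks `hgen` in all
dimensions but its proof — bounded plane volumes → cylindrical cells → Newton–Leibniz to algebraic
intervals → real Puiseux charts — only produces generators of dimension `0` and `1`).
[cite: KontsevichZagier2001, §1.2] -/
def DimLeOneGeneratorsLeOne : Prop :=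
  ∀ (N : AddSubgroup KZ.FormalRep), KZ.relations ≤ N →
    (∀ {m : ℕ} (t : KZ.IntegralRep m) (g : (Fin m → ℝ) → ℝ) (U : Set (Fin m → ℝ)), m ≤ 1 →
      IsOpen U → Set.pi Set.univ (fun _ : Fin m => Set.Icc (0:ℝ) 1) ⊆ U →
      IsSemialgebraicFunOn ℚ U g → AnalyticOnNhd ℝ g U →
      t.domain = Set.pi Set.univ (fun _ : Fin m => Set.Icc (0:ℝ) 1) →
      (∀ z ∈ Set.pi Set.univ (fun _ : Fin m => Set.Icc (0:ℝ) 1), t.integrand z = g z) → KZ.of t ∈ N) →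
    ∀ {k : ℕ}, k ≤ 1 → ∀ r : KZ.IntegralRep k, KZ.of r ∈ N

end Summit.KontsevichZagierPeriods.KontsevichZagierPeriods.Cruxes.AyoubEffectiveCubeKernel.CurveSector
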